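import Summits.QuantumFields.YangMills.Theorems.BalabanUVNodesN08HaarCompatibilityGuardHaarBallLower
import Mathlib.Analysis.Convex.SpecificFunctions.Deriv
import HarnessLib

/-!
# `UV3BranchExpansionHaarBallSharp` — a SHARP upper bound for the Haar mass of a small ball of `SU(2)`,
# `Haar{‖U − 1‖ < δ} ≤ 2π²δ³/81` (`δ ≤ 1`), and the WINDOW RATIO `h(1/3 + δ′)^M / h(δ′)` of hTop's socket weight as a closed number:
# `≤ 10⁻¹⁰` at `(δ′, M) = (1/21, 8)`, whence the element weight `x = 2·K·q ≤ 3·10⁻⁵` at `L = d = 3` (crux `UnitScaleTilt.HistoryTailL`,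
# stmt-QuantumFields-19936 — SUPPLY side of hTop; count-neutral numerics)

Cell `ym3-torus` (YM ladder rung R3 = continuum SU(2) Yang–Mills on T³ — a RUNG, NOT d = 4, NOT infinite volume, NOT a mass gap, NOT Clay);
width seat `ym3-torus-px13` (gen 14), explicit-unit helper; `--supports stmt-QuantumFields-19936 --as helper`.  THEOREMS ONLY (0 `def`,
0 `sorry`, 0 `instance`, default heartbeats); imports pub-ymgap's ✓`BalabanUVNodesN08HaarCompatibilityGuardHaarBallLower` (dag-n08-w3 g6: the
LOWER bound `h(δ) ≥ (2/3π)(1 − δ²/6)²δ³`, and by import the UPPER bound ✓`…GuardHaarBall.haar_dist1_lt_le` `h(δ) ≤ π²δ³/12` and the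
exponential chart `T4HaarSU2ExpChart.lintegral_haarProbability_su2_exp`, `K⋆ ≤ 3301` of ✓`…GuardKStepMassesSU2.kstar_le`).

WHY (px13 g14 FINDING, 19936 evidence #60 `FINDING-hTop-smallness-numerics-px13g14.md`).  The (C′) count of hTop
(✓`UV3BranchExpansionCountingAmortizedUniform.sum_pow_card_le_exp_of_smallness` ∕ (F-C′-inst)) closes at `L = d = 3` iff the element weight
`x = 2·K·q`, `q = h(1/3 + δ′)^{L^{d−1}−1}/h(δ′) = h(1/3+δ′)^8/h(δ′)` (✓`UV3BranchExpansionSocketWeights.hw_of_stackedActivity` ∘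
`admitting_le_pow_div`), `h(r) = Haar_{SU(2)}{dist1 < r}`, is `≲ 1.5·10⁻⁴`.  With the chart bound `π²δ³/12` (Jordan's `π/2`, ≈ 3.9× the exact mass, raised to
the 8th power) the best kernel value is `q ≈ 8·10⁻⁷`, `x ≥ 5·10⁻³` at every `(K, δ′)`: INFEASIBLE.  The chord formula `dist1 (exp ιx) = 2|sin(‖x‖/2)|`
(lit ✓`T4ExpWindowSmallField.dist1_expPoint_eq`) and the CONCAVITY chord `sin t ≥ (3/π)t` on `[0, π/6]` put the `dist1`-ball of radius `δ ≤ 1` inside the chart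
image of the Euclidean ball of radius `(π/3)δ` instead of `(π/2)δ` — a factor `(2/3)³ = 8/27` — which is within 16 % of the exact mass at `δ ≈ 0.38` and
suffices by three orders of magnitude.

WHAT THIS FILE PROVES ([folklore] measure bookkeeping on the landed chart; nothing of Bałaban's asserted).
 §1 `three_div_pi_mul_le_sin` (`0 ≤ t ≤ π/6 ⇒ (3/π)t ≤ sin t`, Mathlib `strictConcaveOn_sin_Icc`) · `norm_lt_of_dist1_expPoint_lt_sharp` (in the chart ball,
    `dist1 (exp ιx) < δ ≤ 1 ⇒ ‖x‖ < (π/3)δ`) · `haar_dist1_lt_le_volume_sharp` · ★ `haar_dist1_lt_le_sharp` (**`h(δ) ≤ 2π²δ³/81`**, `0 ≤ δ ≤ 1`) ·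
    `haar_real_dist1_lt_le_sharp`.
 §2 ★★ `haar_window_ratio_le` (**`h(1/3+δ′)^M / h(δ′) ≤ (2π²(1/3+δ′)³/81)^M / ((2/3π)(1 − δ′²/6)²δ′³)`**, `0 < δ′ ≤ 2/3`, any `M`) · numerals at the FINDING's
    optimum `δ′ = 1/21`: `window_up_le` (`2π²(8/21)³/81 ≤ 339/25000`), `window_low_ge` (`h(1/21) ≥ 2289·10⁻⁸`), ★★ `haar_window_ratio_le_numeral`
    (**`h(8/21)^8 / h(1/21) ≤ 10⁻¹⁰`**); the `HaarData.haar`/`min(1/3, π/2)` forms the socket's `hw` displays at `N = 2` (`haarData_window_ratio_two_le`).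
 §4 (v1.1 APPEND) the block size `L = 5`: ★ `kstar_wide_le` (`K_wide ≤ 71000`), ★★ `haar_window_ratio_le_numeral_24` (`h(8/21)^{24}/h(1/21) ≤ 10⁻⁴⁰`),
    `haarData_window_ratio_two_le_24`, ★★ `two_mul_kstar_wide_mul_ratio_le` (`2·K_wide·q ≤ 10⁻⁵`); §5 (v1.1) ★★ `two_mul_kstar_mul_ratio_le_letters` ∕
    `two_mul_kstar_wide_mul_ratio_le_letters` = §3∕§4 in `UV3BranchExpansionHTopSegment.map_iterFrom_le_exp_smul_su2`'s exact letters (px8 g13),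
    `haar_dist1_lt_ne_zero` (`0 < δ ≤ 1`), `haarData_dist1_lt_one_div_ne_zero` (the `hh0` letter at `δ′ = 1/21`).
 §3 ★★ `two_mul_kstar_mul_ratio_le` : with ✓`kstar_le` (`K⋆ ≤ 3301`, the (H_K) constant of ✓`fibre_law_le_su2`, range `L^{d−1} ≤ 9` ⟺ `L = 3`):
    **`2·K⋆·(h(8/21)^8/h(1/21)) ≤ 3·10⁻⁵`** in `ℝ≥0∞` — the letter «`x ≤ 3·10⁻⁵`» of ✓∕⧗`UV3BranchExpansionCountingSmallness.smallness_T3_of_le` (px13 g14 FILE S),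
    AT `L = 3`, by kernel.  (For the WIDE constant `6.8·10⁴` of ✓`fibre_law_le_su2_wide` the same `q ≤ 10⁻¹⁰` gives `x ≤ 1.4·10⁻⁵`; the RECORD constant
    `3·10⁸` does NOT close `L = 3` — FINDING §4 (ii).)

HONEST FRAMING.  Count-neutral numerics BY IMPORT of landed chart theorems; `dist1` is the tree's operator-type norm via the chord formula; one number for one
choice `(δ′, M) = (1/21, 8)`; nothing of hTop ∕ (F-TOP) ∕ the χ record ∕ (O‴χₛ) ∕ `HistoryTailL` ∕ R3 is proved; N08 NOT discharged; the Yang–Mills mass gap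
(Clay) is NOT proved; nothing continuum ∕ OS.  0 `sorry`, 0 `def`, standard axioms.

References: T. Bałaban, CMP **102** (1985) 255–275 [Balaban1985UV3] p. 260 (the `SU(2)` Haar density `σ(A) = (2π²)⁻¹(sin|A|/|A|)²`);
[Balaban1987RG1] (0.4) p. 253 (the guard radius `1/3`); LEAD note `Cruxes/HistoryTailL/HTopBranchExpansion.md` v1.2 §3, §6.
-/

noncomputable section

open MeasureTheory Metric Set
open scoped ENNReal

namespace Summit.QuantumFields.YangMills.Theorems.UV3BranchExpansionHaarBallSharp

open Literature.MathematicalPhysics.QuantumFieldTheory.Balaban1983to89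
open Literature.MathematicalPhysics.QuantumFieldTheory (haarProbability)
open Literature.MathematicalPhysics.QuantumFieldTheory.Balaban1983to89.T4CubeChartGnomonic (SU2)
open Literature.MathematicalPhysics.QuantumFieldTheory.Balaban1983to89.T4HaarSU2ExpChart
  (expPoint measurable_expPoint lintegral_haarProbability_su2_exp)
open Literature.MathematicalPhysics.QuantumFieldTheory.Balaban1983to89.T4ExpWindowSmallField (dist1_expPoint_eq)
open Summit.QuantumFields.YangMills.BalabanUVNodes.N08HaarCompatibilityGuardHaarBall (volume_ball_three haarData_haar_eq min_third_pi_div_two)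
open Summit.QuantumFields.YangMills.BalabanUVNodes.N08HaarCompatibilityGuardHaarBallLower (haar_dist1_lt_ge)
open Summit.QuantumFields.YangMills.BalabanUVNodes.N08HaarCompatibilityGuardKStepMassesSU2 (kstar_le)

/-! ## §1 The sharp small-ball bound `h(δ) ≤ 2π²δ³/81` -/

section Ball

/-- **THE CONCAVITY CHORD OF `sin` ON `[0, π/6]`**: `(3/π)·t ≤ sin t` for `0 ≤ t ≤ π/6` (`sin` is concave on `[0, π]`, `sin(π/6) = 1/2`). [folklore] -/
theorem three_div_pi_mul_le_sin {t : ℝ} (h0 : 0 ≤ t) (h1 : t ≤ Real.pi / 6) : 3 / Real.pi * t ≤ Real.sin t := by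
  have hπ := Real.pi_pos
  set b : ℝ := t / (Real.pi / 6) with hb
  have hb0 : 0 ≤ b := div_nonneg h0 (by positivity)
  have hb1 : b ≤ 1 := by rw [hb, div_le_one (by positivity)]; exact h1
  have hmem0 : (0 : ℝ) ∈ Icc 0 Real.pi := ⟨le_rfl, hπ.le⟩
  have hmem1 : Real.pi / 6 ∈ Icc 0 Real.pi := ⟨by positivity, by linarith⟩
  have hc := strictConcaveOn_sin_Icc.concaveOn.2 hmem0 hmem1 (by linarith : 0 ≤ 1 - b) hb0 (by ring : (1 - b) + b = 1)
  simp only [smul_eq_mul, mul_zero, Real.sin_zero, zero_add, Real.sin_pi_div_six] at hc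
  have ht : b * (Real.pi / 6) = t := by rw [hb]; field_simp
  rw [ht] at hc
  calc 3 / Real.pi * t = b * (1 / 2) := by rw [hb]; field_simp; ring
    _ ≤ Real.sin t := hc

/-- **IN THE CHART BALL, `‖exp ιx − 1‖ < δ ≤ 1` FORCES `‖x‖ < (π/3)δ`**: by the chord formula `‖exp ιx − 1‖ = 2 sin(‖x‖/2)` (`‖x‖ < π`),
`sin(‖x‖/2) < δ/2 ≤ 1/2 = sin(π/6)` gives `‖x‖/2 < π/6`, where `sin(‖x‖/2) ≥ (3/π)(‖x‖/2)`.  (✓`…GuardHaarBall.norm_lt_of_dist1_expPoint_lt` has `(π/2)δ`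
from Jordan's inequality.) [folklore] -/
theorem norm_lt_of_dist1_expPoint_lt_sharp {x : EuclideanSpace ℝ (Fin 3)} (hx : x ∈ ball (0 : EuclideanSpace ℝ (Fin 3)) Real.pi)
    {δ : ℝ} (hδ : δ ≤ 1) (h : dist1 (expPoint x) < δ) : ‖x‖ < Real.pi / 3 * δ := by
  have hπ := Real.pi_pos
  have hxπ : ‖x‖ < Real.pi := mem_ball_zero_iff.1 hx
  have hx0 : 0 ≤ ‖x‖ := norm_nonneg x
  rw [dist1_expPoint_eq] at h
  have hs0 : 0 ≤ Real.sin (‖x‖ / 2) := Real.sin_nonneg_of_nonneg_of_le_pi (by positivity) (by linarith)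
  rw [abs_of_nonneg hs0] at h
  -- `sin(‖x‖/2) < 1/2 = sin(π/6)` forces `‖x‖/2 < π/6` (`sin` is monotone on `[−π/2, π/2]`)
  have hlt : ‖x‖ / 2 < Real.pi / 6 := by
    refine lt_of_not_ge fun hle => ?_
    have h1 : Real.sin (Real.pi / 6) ≤ Real.sin (‖x‖ / 2) :=
      Real.strictMonoOn_sin.monotoneOn ⟨by linarith, by linarith⟩ ⟨by linarith, by linarith⟩ hle
    rw [Real.sin_pi_div_six] at h1
    linarith
  have hc := three_div_pi_mul_le_sin (t := ‖x‖ / 2) (by positivity) hlt.le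
  have h2 : 3 / Real.pi * (‖x‖ / 2) < δ / 2 := lt_of_le_of_lt hc (by linarith)
  have e : ‖x‖ = 3 / Real.pi * (‖x‖ / 2) * (2 * Real.pi / 3) := by field_simp
  calc ‖x‖ = 3 / Real.pi * (‖x‖ / 2) * (2 * Real.pi / 3) := e
    _ < δ / 2 * (2 * Real.pi / 3) := mul_lt_mul_of_pos_right h2 (by positivity)
    _ = Real.pi / 3 * δ := by ring

/-- **`Haar_{SU(2)}{U | ‖U − 1‖ < δ} ≤ (2π²)⁻¹ · vol(B_{ℝ³}(0, (π/3)δ))`** for `δ ≤ 1` — ✓`…GuardHaarBall.haar_dist1_lt_le_volume`'s proof with the sharp radius.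
[cite: Balaban1985UV3, p.260 (the SU(2) Haar density; bookkeeping)] -/
theorem haar_dist1_lt_le_volume_sharp {δ : ℝ} (hδ : δ ≤ 1) :
    haarProbability SU2 {U : SU2 | dist1 U < δ} ≤
      ENNReal.ofReal (1 / (2 * Real.pi ^ 2)) * volume (ball (0 : EuclideanSpace ℝ (Fin 3)) (Real.pi / 3 * δ)) := by
  have hmeas : MeasurableSet {U : SU2 | dist1 U < δ} := measurableSet_lt RegularGaugeGroup.measurable_dist1 measurable_const
  rw [← lintegral_indicator_one hmeas, lintegral_haarProbability_su2_exp _ (measurable_one.indicator hmeas)]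
  gcongr
  calc ∫⁻ x in ball (0 : EuclideanSpace ℝ (Fin 3)) Real.pi, ({U : SU2 | dist1 U < δ}.indicator 1 (expPoint x)) * ENNReal.ofReal (Real.sinc ‖x‖ ^ 2)
      ≤ ∫⁻ x in ball (0 : EuclideanSpace ℝ (Fin 3)) Real.pi, (ball (0 : EuclideanSpace ℝ (Fin 3)) (Real.pi / 3 * δ)).indicator 1 x := by
        refine setLIntegral_mono (measurable_one.indicator measurableSet_ball) fun x hx => ?_
        by_cases h : dist1 (expPoint x) < δ
        · have hxr : x ∈ ball (0 : EuclideanSpace ℝ (Fin 3)) (Real.pi / 3 * δ) := by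
            rw [mem_ball_zero_iff]; exact norm_lt_of_dist1_expPoint_lt_sharp hx hδ h
          rw [indicator_of_mem (show expPoint x ∈ {U : SU2 | dist1 U < δ} from h), indicator_of_mem hxr, Pi.one_apply, Pi.one_apply, one_mul]
          have h1 : Real.sinc ‖x‖ ^ 2 ≤ 1 := by rw [sq_le_one_iff_abs_le_one]; exact Real.abs_sinc_le_one _
          exact ENNReal.ofReal_le_one.2 h1
        · rw [indicator_of_notMem (show expPoint x ∉ {U : SU2 | dist1 U < δ} from h), zero_mul]
          exact zero_le
    _ ≤ ∫⁻ x, (ball (0 : EuclideanSpace ℝ (Fin 3)) (Real.pi / 3 * δ)).indicator 1 x := setLIntegral_le_lintegral _ _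
    _ = volume (ball (0 : EuclideanSpace ℝ (Fin 3)) (Real.pi / 3 * δ)) := lintegral_indicator_one measurableSet_ball

/-- ★ **`Haar_{SU(2)}{U | ‖U − 1‖ < δ} ≤ 2π²δ³/81`** for `0 ≤ δ ≤ 1` (`(2π²)⁻¹·(4π/3)·((π/3)δ)³`; ✓`haar_dist1_lt_le` has `π²δ³/12`, `27/8` times larger).
[cite: Balaban1985UV3, p.260 (the SU(2) Haar density; bookkeeping)] -/
theorem haar_dist1_lt_le_sharp {δ : ℝ} (hδ0 : 0 ≤ δ) (hδ : δ ≤ 1) :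
    haarProbability SU2 {U : SU2 | dist1 U < δ} ≤ ENNReal.ofReal (2 * Real.pi ^ 2 * δ ^ 3 / 81) := by
  refine (haar_dist1_lt_le_volume_sharp hδ).trans ?_
  rw [volume_ball_three (by positivity), ← ENNReal.ofReal_mul (by positivity)]
  refine ENNReal.ofReal_le_ofReal (le_of_eq ?_)
  have hπ : Real.pi ≠ 0 := Real.pi_pos.ne'
  field_simp
  ring

/-- The real-valued form: `Haar_{SU(2)}.real {‖U − 1‖ < δ} ≤ 2π²δ³/81` for `0 ≤ δ ≤ 1`. [cite: Balaban1985UV3, p.260 (bookkeeping)] -/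
theorem haar_real_dist1_lt_le_sharp {δ : ℝ} (hδ0 : 0 ≤ δ) (hδ : δ ≤ 1) :
    (haarProbability SU2).real {U : SU2 | dist1 U < δ} ≤ 2 * Real.pi ^ 2 * δ ^ 3 / 81 :=
  ENNReal.toReal_le_of_le_ofReal (by positivity) (haar_dist1_lt_le_sharp hδ0 hδ)

end Ball

/-! ## §2 The window ratio `h(1/3 + δ′)^M / h(δ′)` as a closed number -/

section Window

/-- ★★ **THE WINDOW RATIO OF THE SOCKET WEIGHT IN CLOSED FORM**: for `0 < δ′ ≤ 2/3` and every exponent `M`,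
`h(1/3 + δ′)^M / h(δ′) ≤ (2π²(1/3 + δ′)³/81)^M / ((2/3π)(1 − δ′²/6)²δ′³)` (numerator by §1's sharp bound at `1/3 + δ′ ≤ 1`, denominator by
✓`haar_dist1_lt_ge`). [cite: Balaban1985UV3, p.260 (bookkeeping)] -/
theorem haar_window_ratio_le {δ' : ℝ} (hδ'0 : 0 < δ') (hδ' : δ' ≤ 2 / 3) (M : ℕ) :
    haarProbability SU2 {U : SU2 | dist1 U < 1 / 3 + δ'} ^ M / haarProbability SU2 {U : SU2 | dist1 U < δ'} ≤
      ENNReal.ofReal ((2 * Real.pi ^ 2 * (1 / 3 + δ') ^ 3 / 81) ^ M / (2 / (3 * Real.pi) * ((1 - δ' ^ 2 / 6) ^ 2 * δ' ^ 3))) := by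
  have hπ := Real.pi_pos
  have hup : haarProbability SU2 {U : SU2 | dist1 U < 1 / 3 + δ'} ^ M ≤ ENNReal.ofReal ((2 * Real.pi ^ 2 * (1 / 3 + δ') ^ 3 / 81) ^ M) := by
    rw [ENNReal.ofReal_pow (by positivity)]
    exact pow_le_pow_left' (haar_dist1_lt_le_sharp (by linarith) (by linarith)) M
  have hlow : ENNReal.ofReal (2 / (3 * Real.pi) * ((1 - δ' ^ 2 / 6) ^ 2 * δ' ^ 3)) ≤ haarProbability SU2 {U : SU2 | dist1 U < δ'} :=
    haar_dist1_lt_ge hδ'0.le (by linarith)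
  have hlowpos : 0 < 2 / (3 * Real.pi) * ((1 - δ' ^ 2 / 6) ^ 2 * δ' ^ 3) := by
    have h1 : 0 < 1 - δ' ^ 2 / 6 := by nlinarith
    positivity
  calc haarProbability SU2 {U : SU2 | dist1 U < 1 / 3 + δ'} ^ M / haarProbability SU2 {U : SU2 | dist1 U < δ'}
      ≤ ENNReal.ofReal ((2 * Real.pi ^ 2 * (1 / 3 + δ') ^ 3 / 81) ^ M) / ENNReal.ofReal (2 / (3 * Real.pi) * ((1 - δ' ^ 2 / 6) ^ 2 * δ' ^ 3)) :=
        ENNReal.div_le_div hup hlow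
    _ = ENNReal.ofReal ((2 * Real.pi ^ 2 * (1 / 3 + δ') ^ 3 / 81) ^ M / (2 / (3 * Real.pi) * ((1 - δ' ^ 2 / 6) ^ 2 * δ' ^ 3))) :=
        (ENNReal.ofReal_div_of_pos hlowpos).symm

/-- `2π²(8/21)³/81 ≤ 339/25000 = 0.01356` (`π < 3.15`): the sharp ball bound at the FINDING's optimum radius `1/3 + 1/21 = 8/21`. [folklore] -/
theorem window_up_le : 2 * Real.pi ^ 2 * (1 / 3 + 1 / 21 : ℝ) ^ 3 / 81 ≤ 339 / 25000 := by
  have h := Real.pi_lt_d2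
  have h0 := Real.pi_pos
  nlinarith

/-- `(2/3π)(1 − (1/21)²/6)²(1/21)³ ≥ 2289·10⁻⁸` (`π < 3.1416`): the lower ball bound at `δ′ = 1/21`. [folklore] -/
theorem window_low_ge : (2289 / 100000000 : ℝ) ≤ 2 / (3 * Real.pi) * ((1 - (1 / 21 : ℝ) ^ 2 / 6) ^ 2 * (1 / 21 : ℝ) ^ 3) := by
  have hπ := Real.pi_pos
  have hπ4 : Real.pi < 3.1416 := Real.pi_lt_d4
  rw [div_mul_eq_mul_div, le_div_iff₀ (by positivity)]
  nlinarith

/-- ★★ **THE WINDOW RATIO AT `(δ′, M) = (1/21, 8)` IS BELOW `10⁻¹⁰`**: `h(8/21)^8 / h(1/21) ≤ (339/25000)^8 / (2289·10⁻⁸) ≤ 10⁻¹⁰`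
(`L^{d−1} − 1 = 8` at `L = d = 3`). [cite: Balaban1985UV3, p.260 (bookkeeping)] -/
theorem haar_window_ratio_le_numeral :
    haarProbability SU2 {U : SU2 | dist1 U < 1 / 3 + 1 / 21} ^ 8 / haarProbability SU2 {U : SU2 | dist1 U < 1 / 21} ≤ (10 ^ 10 : ℝ≥0∞)⁻¹ := by
  refine (haar_window_ratio_le (by norm_num) (by norm_num) 8).trans ?_
  have hup0 : 0 ≤ 2 * Real.pi ^ 2 * (1 / 3 + 1 / 21 : ℝ) ^ 3 / 81 := by positivity
  have hnum : (2 * Real.pi ^ 2 * (1 / 3 + 1 / 21 : ℝ) ^ 3 / 81) ^ 8 ≤ (339 / 25000 : ℝ) ^ 8 := pow_le_pow_left₀ hup0 window_up_le 8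
  have hlowpos : (0 : ℝ) < 2289 / 100000000 := by norm_num
  have hratio : (2 * Real.pi ^ 2 * (1 / 3 + 1 / 21 : ℝ) ^ 3 / 81) ^ 8 / (2 / (3 * Real.pi) * ((1 - (1 / 21 : ℝ) ^ 2 / 6) ^ 2 * (1 / 21 : ℝ) ^ 3)) ≤
      (339 / 25000 : ℝ) ^ 8 / (2289 / 100000000) :=
    div_le_div₀ (by positivity) hnum hlowpos window_low_ge
  have hfin : (339 / 25000 : ℝ) ^ 8 / (2289 / 100000000) ≤ 1 / 10 ^ 10 := by norm_num
  calc ENNReal.ofReal ((2 * Real.pi ^ 2 * (1 / 3 + 1 / 21 : ℝ) ^ 3 / 81) ^ 8 / (2 / (3 * Real.pi) * ((1 - (1 / 21 : ℝ) ^ 2 / 6) ^ 2 * (1 / 21 : ℝ) ^ 3)))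
      ≤ ENNReal.ofReal (1 / 10 ^ 10 : ℝ) := ENNReal.ofReal_le_ofReal (hratio.trans hfin)
    _ = (10 ^ 10 : ℝ≥0∞)⁻¹ := by
        rw [one_div, ENNReal.ofReal_inv_of_pos (by positivity)]
        norm_num

/-- **THE SAME NUMBER IN THE SOCKET's LETTERS AT `N = 2`** (`HaarData.haar` on `SU 2`, guard radius `min(1/3, π/2) = 1/3`): the window ratio displayed by
✓`UV3BranchExpansionSocketWeights`-type `hw` constants, `Haar{dist1 < min(1/3, π/2) + 1/21}^8 / Haar{dist1 < 1/21} ≤ 10⁻¹⁰`.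
[cite: Balaban1987RG1, (0.4) p.253 (bookkeeping)] -/
theorem haarData_window_ratio_two_le :
    (HaarData.haar : Measure (Node00.SU 2)) {g : Node00.SU 2 | dist1 g < min (1 / 3) (Real.pi / (2 : ℕ)) + 1 / 21} ^ 8 /
        (HaarData.haar : Measure (Node00.SU 2)) {g : Node00.SU 2 | dist1 g < 1 / 21} ≤ (10 ^ 10 : ℝ≥0∞)⁻¹ := by
  rw [min_third_pi_div_two, haarData_haar_eq]
  exact haar_window_ratio_le_numeral

end Window

/-! ## §3 The element weight at `L = 3`: `x = 2·K⋆·q ≤ 3·10⁻⁵` -/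

section Weight

/-- ★★ **THE ELEMENT WEIGHT OF hTop's COUNT AT `L = d = 3` IS BELOW `3·10⁻⁵`**: with the (H_K) constant `K⋆ = m⋆⁻¹ + 1 ≤ 3301` of ✓`fibre_law_le_su2`
(✓`kstar_le`) and the window ratio `q = h(8/21)^8/h(1/21) ≤ 10⁻¹⁰` of §2, `2·K⋆·q ≤ 2·3301·10⁻¹⁰ ≤ 3·10⁻⁵` — the one displayed letter of
`UV3BranchExpansionCountingSmallness.smallness_T3_of_le`. [cite: Balaban1985UV3, p.260 (bookkeeping)] -/
theorem two_mul_kstar_mul_ratio_le :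
    2 * (((ENNReal.ofReal (((1 / 9 : ℝ) * Real.sin 1 * (Real.sin (Real.pi / 3) / (Real.pi / 3))) ^ 3 *
        (Real.sin (Real.pi / 3) / (Real.pi / 3)) ^ 2))⁻¹ + 1 : ℝ≥0∞) *
        (haarProbability SU2 {U : SU2 | dist1 U < 1 / 3 + 1 / 21} ^ 8 / haarProbability SU2 {U : SU2 | dist1 U < 1 / 21})) ≤
      ENNReal.ofReal (3 / 100000) := by
  calc 2 * (((ENNReal.ofReal (((1 / 9 : ℝ) * Real.sin 1 * (Real.sin (Real.pi / 3) / (Real.pi / 3))) ^ 3 *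
        (Real.sin (Real.pi / 3) / (Real.pi / 3)) ^ 2))⁻¹ + 1 : ℝ≥0∞) *
        (haarProbability SU2 {U : SU2 | dist1 U < 1 / 3 + 1 / 21} ^ 8 / haarProbability SU2 {U : SU2 | dist1 U < 1 / 21}))
      ≤ 2 * ((3301 : ℝ≥0∞) * (10 ^ 10 : ℝ≥0∞)⁻¹) := by gcongr; exacts [kstar_le, haar_window_ratio_le_numeral]
    _ ≤ ENNReal.ofReal (3 / 100000) := by
        have hfin : (2 : ℝ≥0∞) * ((3301 : ℝ≥0∞) * (10 ^ 10 : ℝ≥0∞)⁻¹) ≠ ⊤ :=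
          ENNReal.mul_ne_top (by norm_num) (ENNReal.mul_ne_top (by norm_num) (ENNReal.inv_ne_top.2 (by positivity)))
        rw [← ENNReal.toReal_le_toReal hfin ENNReal.ofReal_ne_top, ENNReal.toReal_ofReal (by norm_num : (0 : ℝ) ≤ 3 / 100000),
          ENNReal.toReal_mul, ENNReal.toReal_mul, ENNReal.toReal_inv, ENNReal.toReal_pow]
        norm_num

end Weight

/-! ## §4 (v1.1 APPEND) The block size `L = 5`: the WIDE constant and the exponent `L² − 1 = 24`

At `d = 3`, `L = 5` the (H_K) supplier is ✓`…GuardCoreLawSU2Wide.fibre_law_le_su2_wide` (range `L^{d−1} ≤ 25`) with `K_wide = m⋆(1/25)⁻¹ + 1`;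
no tree numeral existed for it (✓`kstar_le` is the `1/9` constant, ✓`kstar_record_le` the `1/400` one).  The window exponent is `L^{d−1} − 1 = 24`. -/

section Wide

/-- ★ **THE WIDE CONSTANT IS A NUMBER: `K_wide = m⋆(1/25)⁻¹ + 1 ≤ 71000`** (`m⋆(1/25) = ((1/25)·sin 1·s)³·s²`, `s = sin(π/3)/(π/3)`; `sin 1 ≥ 5/6`,
`√3 ≥ 1.732`, `π ≤ 3.1416` give `m⋆ ≥ 1/70999`) — ✓`kstar_le`'s proof at the ratio `1/25` of ✓`core_law_le_su2_wide`. [folklore] -/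
theorem kstar_wide_le : ((ENNReal.ofReal (((1 / 25 : ℝ) * Real.sin 1 * (Real.sin (Real.pi / 3) / (Real.pi / 3))) ^ 3 *
      (Real.sin (Real.pi / 3) / (Real.pi / 3)) ^ 2))⁻¹ + 1 : ℝ≥0∞) ≤ 71000 := by
  set q : ℝ := Real.sin (Real.pi / 3) / (Real.pi / 3) with hq_def
  set κ : ℝ := (1 / 25 : ℝ) * Real.sin 1 * q with hκ_def
  have hs1 : (5 / 6 : ℝ) ≤ Real.sin 1 := by
    have := Real.sin_gt_sub_cube (x := 1) one_pos; norm_num at this; linarith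
  have hπ : Real.pi < 3.1416 := Real.pi_lt_d4
  have hr3 : (1.732 : ℝ) ≤ Real.sqrt 3 := by
    rw [show (1.732 : ℝ) = Real.sqrt (1.732 ^ 2) from (Real.sqrt_sq (by norm_num)).symm]
    exact Real.sqrt_le_sqrt (by norm_num)
  have hq : (0.826 : ℝ) ≤ q := by
    rw [hq_def, Real.sin_pi_div_three, le_div_iff₀ (by positivity)]
    nlinarith
  have hκ : (0.02753 : ℝ) ≤ κ := by rw [hκ_def]; nlinarith
  have hm : (1 / 70999 : ℝ) ≤ κ ^ 3 * q ^ 2 := by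
    have h1 : (0.02753 : ℝ) ^ 3 ≤ κ ^ 3 := pow_le_pow_left₀ (by norm_num) hκ 3
    have h2 : (0.826 : ℝ) ^ 2 ≤ q ^ 2 := pow_le_pow_left₀ (by norm_num) hq 2
    calc (1 / 70999 : ℝ) ≤ (0.02753 : ℝ) ^ 3 * (0.826 : ℝ) ^ 2 := by norm_num
      _ ≤ κ ^ 3 * q ^ 2 := mul_le_mul h1 h2 (by norm_num) (le_trans (by norm_num) h1)
  have hinv : (ENNReal.ofReal (κ ^ 3 * q ^ 2))⁻¹ ≤ 70999 := by
    calc (ENNReal.ofReal (κ ^ 3 * q ^ 2))⁻¹ ≤ (ENNReal.ofReal (1 / 70999 : ℝ))⁻¹ := ENNReal.inv_le_inv.2 (ENNReal.ofReal_le_ofReal hm)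
      _ = 70999 := by
          rw [one_div, ENNReal.ofReal_inv_of_pos (by norm_num), inv_inv]
          norm_num
  calc (ENNReal.ofReal (κ ^ 3 * q ^ 2))⁻¹ + 1 ≤ 70999 + 1 := add_le_add hinv le_rfl
    _ = 71000 := by norm_num

/-- ★★ **THE WINDOW RATIO AT `(δ′, M) = (1/21, 24)` IS BELOW `10⁻⁴⁰`**: `h(8/21)^{24} / h(1/21) ≤ (339/25000)^{24} / (2289·10⁻⁸) ≤ 10⁻⁴⁰`
(`L^{d−1} − 1 = 24` at `d = 3`, `L = 5`). [cite: Balaban1985UV3, p.260 (bookkeeping)] -/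
theorem haar_window_ratio_le_numeral_24 :
    haarProbability SU2 {U : SU2 | dist1 U < 1 / 3 + 1 / 21} ^ 24 / haarProbability SU2 {U : SU2 | dist1 U < 1 / 21} ≤ (10 ^ 40 : ℝ≥0∞)⁻¹ := by
  refine (haar_window_ratio_le (by norm_num) (by norm_num) 24).trans ?_
  have hup0 : 0 ≤ 2 * Real.pi ^ 2 * (1 / 3 + 1 / 21 : ℝ) ^ 3 / 81 := by positivity
  have hnum : (2 * Real.pi ^ 2 * (1 / 3 + 1 / 21 : ℝ) ^ 3 / 81) ^ 24 ≤ (339 / 25000 : ℝ) ^ 24 := pow_le_pow_left₀ hup0 window_up_le 24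
  have hlowpos : (0 : ℝ) < 2289 / 100000000 := by norm_num
  have hratio : (2 * Real.pi ^ 2 * (1 / 3 + 1 / 21 : ℝ) ^ 3 / 81) ^ 24 / (2 / (3 * Real.pi) * ((1 - (1 / 21 : ℝ) ^ 2 / 6) ^ 2 * (1 / 21 : ℝ) ^ 3)) ≤
      (339 / 25000 : ℝ) ^ 24 / (2289 / 100000000) :=
    div_le_div₀ (by positivity) hnum hlowpos window_low_ge
  have hfin : (339 / 25000 : ℝ) ^ 24 / (2289 / 100000000) ≤ 1 / 10 ^ 40 := by norm_num
  calc ENNReal.ofReal ((2 * Real.pi ^ 2 * (1 / 3 + 1 / 21 : ℝ) ^ 3 / 81) ^ 24 / (2 / (3 * Real.pi) * ((1 - (1 / 21 : ℝ) ^ 2 / 6) ^ 2 * (1 / 21 : ℝ) ^ 3)))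
      ≤ ENNReal.ofReal (1 / 10 ^ 40 : ℝ) := ENNReal.ofReal_le_ofReal (hratio.trans hfin)
    _ = (10 ^ 40 : ℝ≥0∞)⁻¹ := by
        rw [one_div, ENNReal.ofReal_inv_of_pos (by positivity)]
        norm_num

/-- The same number in the socket's letters at `N = 2` (`HaarData.haar` on `SU 2`, guard radius `min(1/3, π/2)`):
`Haar{dist1 < min(1/3, π/2) + 1/21}^{24} / Haar{dist1 < 1/21} ≤ 10⁻⁴⁰`. [cite: Balaban1987RG1, (0.4) p.253 (bookkeeping)] -/
theorem haarData_window_ratio_two_le_24 :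
    (HaarData.haar : Measure (Node00.SU 2)) {g : Node00.SU 2 | dist1 g < min (1 / 3) (Real.pi / (2 : ℕ)) + 1 / 21} ^ 24 /
        (HaarData.haar : Measure (Node00.SU 2)) {g : Node00.SU 2 | dist1 g < 1 / 21} ≤ (10 ^ 40 : ℝ≥0∞)⁻¹ := by
  rw [min_third_pi_div_two, haarData_haar_eq]
  exact haar_window_ratio_le_numeral_24

/-- ★★ **THE ELEMENT WEIGHT OF hTop's COUNT AT `L = 5`, `d = 3` IS BELOW `10⁻⁵`** (indeed below `10⁻³⁴`): with `K_wide ≤ 71000` and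
`q = h(8/21)^{24}/h(1/21) ≤ 10⁻⁴⁰`, `2·K_wide·q ≤ 10⁻⁵` — the displayed letter of the `L = 5` numeral instance of
`UV3BranchExpansionCountingSmallnessT3` (`(r₀, ρ₀, s₀, L − 1) = (750, 6, 20, 4)`, `(y, θ₀) = (9/10, 7/10)`). [cite: Balaban1985UV3, p.260 (bookkeeping)] -/
theorem two_mul_kstar_wide_mul_ratio_le :
    2 * (((ENNReal.ofReal (((1 / 25 : ℝ) * Real.sin 1 * (Real.sin (Real.pi / 3) / (Real.pi / 3))) ^ 3 *
        (Real.sin (Real.pi / 3) / (Real.pi / 3)) ^ 2))⁻¹ + 1 : ℝ≥0∞) *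
        (haarProbability SU2 {U : SU2 | dist1 U < 1 / 3 + 1 / 21} ^ 24 / haarProbability SU2 {U : SU2 | dist1 U < 1 / 21})) ≤
      ENNReal.ofReal (1 / 100000) := by
  calc 2 * (((ENNReal.ofReal (((1 / 25 : ℝ) * Real.sin 1 * (Real.sin (Real.pi / 3) / (Real.pi / 3))) ^ 3 *
        (Real.sin (Real.pi / 3) / (Real.pi / 3)) ^ 2))⁻¹ + 1 : ℝ≥0∞) *
        (haarProbability SU2 {U : SU2 | dist1 U < 1 / 3 + 1 / 21} ^ 24 / haarProbability SU2 {U : SU2 | dist1 U < 1 / 21}))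
      ≤ 2 * ((71000 : ℝ≥0∞) * (10 ^ 40 : ℝ≥0∞)⁻¹) := by gcongr; exacts [kstar_wide_le, haar_window_ratio_le_numeral_24]
    _ ≤ ENNReal.ofReal (1 / 100000) := by
        have hfin : (2 : ℝ≥0∞) * ((71000 : ℝ≥0∞) * (10 ^ 40 : ℝ≥0∞)⁻¹) ≠ ⊤ :=
          ENNReal.mul_ne_top (by norm_num) (ENNReal.mul_ne_top (by norm_num) (ENNReal.inv_ne_top.2 (by positivity)))
        rw [← ENNReal.toReal_le_toReal hfin ENNReal.ofReal_ne_top, ENNReal.toReal_ofReal (by norm_num : (0 : ℝ) ≤ 1 / 100000),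
          ENNReal.toReal_mul, ENNReal.toReal_mul, ENNReal.toReal_inv, ENNReal.toReal_pow]
        norm_num

end Wide

/-! ## §5 (v1.1 APPEND) The two weights in the EXACT letters of px8 g13's `UV3BranchExpansionHTopSegment.map_iterFrom_le_exp_smul_su2`
(`HaarData.haar` on `Matrix.specialUnitaryGroup (Fin 2) ℂ`, radius `1/3 + δ′`, exponent `P.L ^ (P.d − 1) − 1` left unevaluated at the literal
`(d, L) = (3, 3)` resp. `(3, 5)`), so the T³ knit (w5 g19 (F-TOP-T3L3)) can `exact` them after `P.d = 3`, `P.L = 3` are rewritten. -/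

section Letters

/-- ★★ `2·(K⋆·(Haar{dist1 < 1/3 + 1/21}^{3^{3−1} − 1} / Haar{dist1 < 1/21})) ≤ ofReal (3·10⁻⁵)` — §3 in `…HTopSegment`'s letters at `(d, L) = (3, 3)`, `δ′ = 1/21`.
[cite: Balaban1985UV3, p.260 (bookkeeping)] -/
theorem two_mul_kstar_mul_ratio_le_letters :
    2 * ((((ENNReal.ofReal (((1 / 9 : ℝ) * Real.sin 1 * (Real.sin (Real.pi / 3) / (Real.pi / 3))) ^ 3 *
        (Real.sin (Real.pi / 3) / (Real.pi / 3)) ^ 2))⁻¹ + 1) *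
        ((HaarData.haar : Measure (Matrix.specialUnitaryGroup (Fin 2) ℂ)) {g | dist1 g < 1 / 3 + 1 / 21} ^ (3 ^ (3 - 1) - 1) /
          (HaarData.haar : Measure (Matrix.specialUnitaryGroup (Fin 2) ℂ)) {g | dist1 g < 1 / 21}))) ≤
      ENNReal.ofReal (3 / 100000) := by
  rw [show (3 : ℕ) ^ (3 - 1) - 1 = 8 by norm_num, haarData_haar_eq]
  exact two_mul_kstar_mul_ratio_le

/-- ★★ `2·(K_wide·(Haar{dist1 < 1/3 + 1/21}^{5^{3−1} − 1} / Haar{dist1 < 1/21})) ≤ ofReal (10⁻⁵)` — §4 in the same letters at `(d, L) = (3, 5)`, `δ′ = 1/21`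
(for a `…HTopSegment`-type engine over ✓`hw_su2_of_pow_le_twentyfive`). [cite: Balaban1985UV3, p.260 (bookkeeping)] -/
theorem two_mul_kstar_wide_mul_ratio_le_letters :
    2 * ((((ENNReal.ofReal (((1 / 25 : ℝ) * Real.sin 1 * (Real.sin (Real.pi / 3) / (Real.pi / 3))) ^ 3 *
        (Real.sin (Real.pi / 3) / (Real.pi / 3)) ^ 2))⁻¹ + 1) *
        ((HaarData.haar : Measure (Matrix.specialUnitaryGroup (Fin 2) ℂ)) {g | dist1 g < 1 / 3 + 1 / 21} ^ (5 ^ (3 - 1) - 1) /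
          (HaarData.haar : Measure (Matrix.specialUnitaryGroup (Fin 2) ℂ)) {g | dist1 g < 1 / 21}))) ≤
      ENNReal.ofReal (1 / 100000) := by
  rw [show (5 : ℕ) ^ (3 - 1) - 1 = 24 by norm_num, haarData_haar_eq]
  exact two_mul_kstar_wide_mul_ratio_le

/-- **A SMALL `dist1`-BALL HAS POSITIVE HAAR MASS**: `Haar_{SU(2)}{dist1 < δ} ≠ 0` for `0 < δ ≤ 1` (✓`haar_dist1_lt_ge`'s lower bound is positive) — the
`hh0` letter of the window weights. [cite: Balaban1985UV3, p.260 (bookkeeping)] -/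
theorem haar_dist1_lt_ne_zero {δ : ℝ} (hδ0 : 0 < δ) (hδ1 : δ ≤ 1) : haarProbability SU2 {U : SU2 | dist1 U < δ} ≠ 0 := by
  intro h0
  have hle := haar_dist1_lt_ge hδ0.le hδ1
  rw [h0, nonpos_iff_eq_zero, ENNReal.ofReal_eq_zero] at hle
  have h1 : 0 < 1 - δ ^ 2 / 6 := by nlinarith
  have hpos : 0 < 2 / (3 * Real.pi) * ((1 - δ ^ 2 / 6) ^ 2 * δ ^ 3) := by have := Real.pi_pos; positivity
  linarith

/-- `hh0` in `…HTopSegment`'s letters at `δ′ = 1/21`: `(HaarData.haar : Measure SU(2)) {g | dist1 g < 1/21} ≠ 0`. [cite: Balaban1985UV3, p.260 (bookkeeping)] -/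
theorem haarData_dist1_lt_one_div_ne_zero :
    (HaarData.haar : Measure (Matrix.specialUnitaryGroup (Fin 2) ℂ)) {g | dist1 g < 1 / 21} ≠ 0 := by
  rw [haarData_haar_eq]
  exact haar_dist1_lt_ne_zero (by norm_num) (by norm_num)

end Letters

end Summit.QuantumFields.YangMills.Theorems.UV3BranchExpansionHaarBallSharp

end
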